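import Mathlib
import Literature.Combinatorics.Optimization.PseudoexpectationRefutesCubeCertificate
import Literature.Combinatorics.Optimization.MaxKSatSosGap
import Literature.Computability.MetaComplexity.SumOfSquaresProofs

/-!
# Kothari–Mori–O'Donnell–Witmer 2017 (Thm 7.1, `k`-SAT) in the Lee–Raghavendra–Steurer currency:
# with high probability the random Max-`k`-SAT instance has no cube sum-of-squares certificate
# below `1` up to the KMOW degree — PROVED

The tree proves KMOW's random-`k`-SAT theorem `kmow_sos_random_kSAT_holds`
(`Literature/Computability/MetaComplexity/SumOfSquaresProofs.lean`): with probability `≥ 1 − β`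
over `φ ∼ F_k(n, Δn)`, degree-`D` SOS FAILS TO REFUTE `φ`, `D = kmowDegree a b k Δ β n`
(`≍ n/(Δ^{2/(k−2)} log Δ)`), in the MOMENT vocabulary `SOSFailsToRefute` (a degree-`D`
pseudoexpectation satisfying Booleanity and every clause identity).  The bridge
`not_hasSosCertificate_of_pseudoexpectation` (`PseudoexpectationRefutesCubeCertificate.lean`,
Combinatorial Nullstellensatz) converts such a pseudoexpectation into the CUBE-side statement of
Lee–Raghavendra–Steurer: no degree-`≤ D` sum-of-squares certificate of `c − ℑ` on `{0,1}ⁿ` for the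
Max-`k`-SAT instance `ℑ` of the clause tuple and any `c < 1`.  This file records

* `not_hasSosCertificate_of_sosFailsToRefuteK` — the bridge for `k`-clause tuples
  (`satInstanceK` of `MaxKSatSosGap.lean`; the `k = 3` version is
  `not_hasSosCertificate_of_sosFailsToRefute`);
* `kmow_maxKSat_noCubeCertificate` — **KMOW Thm 7.1 for Max-`k`-SAT in cube currency, PROVED:**
  universal `a, b > 0`; for all `k ≥ 3`, `Δ ≥ 10`, `0 < β < 1` and all large `n`, with probability
  `≥ 1 − β` over `φ ∼ F_k(n, Δn)`, every clause tuple `ω` presenting `φ` has: for all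
  `d' ≤ kmowDegree a b k Δ β n` and all `c < 1`, no degree-`d'` sum-of-squares certificate of
  `c − ℑ_ω` (so the degree-`D` Lasserre value of the random Max-`k`-SAT instance is `1`).

No definitions, no facts (D-0026).

## References

* P. Kothari, R. Mori, R. O'Donnell, D. Witmer, *Sum of squares lower bounds for refuting any CSP*,
  STOC 2017, Thm 7.1 / Thm 1.2 and §2.3 [arXiv170104521].
* J. R. Lee, P. Raghavendra, D. Steurer, STOC 2015, §1–2 (cube sum-of-squares certificates)
  [LeeRaghavendraSteurer2015].
-/

noncomputable section

open Finset Filter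
open Literature.Computability.Complexity (Literal Clause kClauses randomKCNF)
open Literature.Computability.MetaComplexity (SOSFailsToRefute kmowDegree kmow_sos_random_kSAT_holds)

namespace Literature.Combinatorics.Optimization

variable {k n m : ℕ}

/-- **`SOSFailsToRefute d (List.ofFn ω) ⇒` no degree-`d'` cube certificate of `c − ℑ_ω` below `1`**
(`k ≤ d`, `d' ≤ d`), for the Max-`k`-SAT instance `satInstanceK ω` of a `k`-clause tuple.
[cite: arXiv170104521, §2.3 (pseudoexpectations for `k`-SAT)] -/
theorem not_hasSosCertificate_of_sosFailsToRefuteK (ω : Fin m → ↥(kClauses k n)) (hm : 0 < m)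
    {d : ℕ} (hkd : k ≤ d)
    (h : SOSFailsToRefute d (List.ofFn fun i => ((ω i : ↥(kClauses k n)) : Clause ℕ)))
    {d' : ℕ} (hd' : d' ≤ d) {c : ℝ} (hc : c < 1) :
    ¬ HasSosCertificate d' (fun x => c - (satInstanceK ω hm).val x) := by
  obtain ⟨E, hE, hB, hC⟩ := h
  refine not_hasSosCertificate_of_pseudoexpectation (satInstanceK ω hm)
    (fun i => ((ω i : ↥(kClauses k n)) : Clause ℕ)) (fun i x σ hσ => satConstraintK_sat (ω i) x σ hσ)
    (fun i => fst_lt_of_mem_kClauses (ω i).2)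
    (fun i => by rw [length_of_mem_kClauses (ω i).2]; exact hkd) hE hB (fun i => hC _ ?_) hd' hc
  rw [List.mem_ofFn]
  exact ⟨i, rfl⟩

/-- The KMOW degree tends to infinity with `n` (fixed `k ≥ 1`, `Δ ≥ 10`, `β > 0`).
[cite: arXiv170104521, Thm 7.1 (`D = Ω̃(n/Δ^{2/(k−2)})`)] -/
theorem tendsto_kmowDegree {a b : ℝ} {k Δ : ℕ} (hk : 1 ≤ k) (hΔ : 10 ≤ Δ) {β : ℝ} (hβ : 0 < β) :
    Tendsto (fun n => kmowDegree a b k Δ β n) atTop atTop := by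
  unfold kmowDegree
  have hΔ1 : (1 : ℝ) < Δ := by exact_mod_cast lt_of_lt_of_le (by norm_num) hΔ
  have hΔ0 : (0 : ℝ) < Δ := by linarith
  have hL : 0 < (Δ : ℝ) ^ ((2 : ℝ) / ((k : ℝ) - 2)) * Real.log Δ :=
    mul_pos (Real.rpow_pos_of_pos hΔ0 _) (Real.log_pos hΔ1)
  have hkpos : (0 : ℝ) < k := by exact_mod_cast hk
  have hC : 0 < β ^ (a / k) / ((k : ℝ) * 2 ^ b) :=
    div_pos (Real.rpow_pos_of_pos hβ _) (mul_pos hkpos (by positivity))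
  refine tendsto_nat_floor_atTop.comp ?_
  have h1 : Tendsto (fun n : ℕ => β ^ (a / k) / ((k : ℝ) * 2 ^ b) * (n : ℝ)) atTop atTop :=
    tendsto_natCast_atTop_atTop.const_mul_atTop hC
  exact h1.atTop_div_const hL

/-- **Kothari–Mori–O'Donnell–Witmer 2017, Thm 7.1 (`k`-SAT) in cube / Lee–Raghavendra–Steurer
currency — PROVED.** There are universal `a, b > 0` such that for all `k ≥ 3`, `Δ ≥ 10`,
`0 < β < 1` and all sufficiently large `n`: with probability at least `1 − β` over
`φ ∼ F_k(n, Δn)`, for every clause tuple `ω` presenting `φ` (`φ = List.ofFn ω`), every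
`d' ≤ kmowDegree a b k Δ β n` and every `c < 1`, the function `c − ℑ_ω` (ℑ_ω the Max-`k`-SAT
instance of `ω`) has NO degree-`d'` sum-of-squares certificate on `{0,1}ⁿ`.  (KMOW's theorem
`kmow_sos_random_kSAT_holds` transported through `not_hasSosCertificate_of_sosFailsToRefuteK`;
the two events differ by the inclusion of sets of CNFs, and `k ≤ kmowDegree … n` eventually.)
[cite: arXiv170104521, Thm 7.1 (= precise Thm 1.2) and §2.3]
[cite: LeeRaghavendraSteurer2015, §1 (sos degree of `c − ℑ`)] -/
theorem kmow_maxKSat_noCubeCertificate :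
    ∃ a b : ℝ, 0 < a ∧ 0 < b ∧ ∀ (k Δ : ℕ), 3 ≤ k → 10 ≤ Δ → ∀ β : ℝ, 0 < β → β < 1 →
      ∀ᶠ n : ℕ in atTop,
        1 - ENNReal.ofReal β ≤ (randomKCNF k n (Δ * n)).toOuterMeasure
          {φ | ∀ (m : ℕ) (hm : 0 < m) (ω : Fin m → ↥(kClauses k n)),
            (List.ofFn fun i => ((ω i : ↥(kClauses k n)) : Clause ℕ)) = φ →
            ∀ d' : ℕ, d' ≤ kmowDegree a b k Δ β n → ∀ c : ℝ, c < 1 →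
              ¬ HasSosCertificate d' (fun x => c - (satInstanceK ω hm).val x)} := by
  obtain ⟨a, b, ha, hb, H⟩ := kmow_sos_random_kSAT_holds
  refine ⟨a, b, ha, hb, fun k Δ hk hΔ β hβ0 hβ1 => ?_⟩
  have hev1 := H k Δ hk hΔ β hβ0 hβ1
  have hev2 : ∀ᶠ n : ℕ in atTop, k ≤ kmowDegree a b k Δ β n :=
    (tendsto_kmowDegree (by omega) hΔ hβ0).eventually_ge_atTop k
  filter_upwards [hev1, hev2] with n h1 h2
  refine h1.trans ((randomKCNF k n (Δ * n)).toOuterMeasure.mono fun φ hφ => ?_)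
  simp only [Set.mem_setOf_eq] at hφ ⊢
  intro m hm ω hω d' hd' c hc
  rw [← hω] at hφ
  exact not_hasSosCertificate_of_sosFailsToRefuteK ω hm h2 hφ hd' hc

end Literature.Combinatorics.Optimization

end
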